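import Literature.Topology.FourManifolds.HomotopyBallSliceProofs
import Literature.Topology.FourManifolds.SmoothDiscShrinking
import Literature.Topology.FourManifolds.InteriorDiscs
import Literature.AlgebraicTopology.SingularHomology.LocalHomologyOfSetTransfer
import Literature.AlgebraicTopology.SingularHomology.LocalHomologyMayerVietorisCriteria
import Literature.AlgebraicTopology.SingularHomology.SphereComplementDegree
import HarnessLib

/-!
# Local homology of a closed `4`-manifold along `e(𝔻⁴) ∪ f(𝔻²)` (a ball with a disc attached)

Let `X` be a closed smooth `4`-manifold and `(e, f)` a slice-disc datum for a knot `K'`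
(`Knot.IsSliceDiscIn K' X e f`, `HomotopyBallSlice.lean`): `e : ℝ⁴ ↪ X` a smooth ball,
`f : ℝ² → X` a smooth proper disc for `K'` in `X ∖ e(B̊⁴)`. Write `A = e(𝔻⁴)`, `D = f(𝔻²)`,
`Γ = A ∩ D = e(K')` (a smooth circle in the boundary sphere of the ball) and `C = A ∪ D`. This file
computes the local homology `H_q(X | C; M) = H_q(X, X ∖ C; M)` in the two degrees needed for the
homology of the Manolescu–Piccirillo manifold `X = X(K') ∪ V`
(`ZeroSurgeryHomotopyBallSliceProofs.lean`, where `X ∖ C` is the interior of the slice-disc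
exterior `V`): for every coefficient module,

* `Knot.IsSliceDiscIn.isZero_localHomologyOfSet_ball_union_disc_three` — `H₃(X | C; M) = 0`;
* `Knot.IsSliceDiscIn.nonempty_localHomologyOfSet_ball_union_disc_two_linearEquiv` —
  `H₂(X | C; M) ≃ M`.

(In the handle language of the source this is `H₃(X(K'), ∂) = 0`, `H₂(X(K'), ∂) ≅ ℤ` for the
`0`-trace `X(K') = B⁴ ∪ h²`, Manolescu–Piccirillo (2023), Definition 3.4 and proof of Lemma 3.3:
"It is routine to confirm that `X` has the homology type of `W`".)

## Proof

All local homology groups are moved into `S⁴` and read off from Hatcher's Prop. 2B.1: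
* `A` and `Γ` lie in the chart `e(ℝ⁴)`; transferring along the open embeddings `e : ℝ⁴ → X` and
  `σ : ℝ⁴ ≅ S⁴ ∖ {pt} ⊂ S⁴` (`localHomologyOfSet.exists_linearEquiv_pair_of_isOpenEmbedding`,
  naturally in the set) gives `H_q(X | A) ≅ H_q(S⁴ | σ𝔻⁴) = 0` (`q = 2, 3`; the complement of the
  injected cube `σ𝔻⁴` is acyclic, Prop. 2B.1(a)), `H₂(X | Γ) = 0`, `H₃(X | Γ) ≅ H₂(S⁴ ∖ σK') ≅ M`
  (Prop. 2B.1(b) for the knot `σ ∘ K' : S¹ ↪ S⁴`, `SphereComplementDegree.lean`), and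
  `H₄(X | A) → H₄(X | Γ)` onto (both are `H₄(S⁴)`);
* the disc `D` is first shrunk by an ambient isotopy into a chart (`exists_homeomorph_image_disc_eq`,
  `SmoothDiscShrinking.lean`), then transferred into `S⁴` in the same way: `H_q(X | D) = 0` for
  `q = 2, 3`;
* the relative Mayer–Vietoris sequence of `C = A ∪ D`, `A ∩ D = Γ`
  (`LocalHomologyMayerVietorisCriteria.lean`) gives `H₃(X | C) = 0` and
  `H₂(X | C) ≅ H₃(X | Γ) ≅ M`.

Everything is proved; no named facts, no definitions.

## References

* C. Manolescu, L. Piccirillo, J. Lond. Math. Soc. 108 (2023), §3.2, Definition 3.4 and proof of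
  Lemma 3.3 [ManolescuPiccirillo2023].
* A. Hatcher, *Algebraic Topology*, CUP 2002, Prop. 2B.1, §2.2 p. 152, §3.3 [HatcherAT2002].
-/

noncomputable section

open Set Function Metric Topology CategoryTheory Limits
open scoped Manifold ContDiff
open Literature.AlgebraicTopology.SingularHomology

universe u

namespace Literature.Topology.FourManifolds

/-! ### Local homology of `S⁴` along injected cubes and circles -/

section SphereFour

variable (R : Type) [CommRing R] (M : Type) [AddCommGroup M] [Module R M]

/-- **Local homology of `S⁴` along a set with acyclic complement** (e.g. an injected cube, disc or
ball, Hatcher Prop. 2B.1(a)): `H_q(S⁴ | K; M) = 0` for `q = 2, 3` (long exact sequence with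
`H_q(S⁴) = 0` and `H_{q-1}(S⁴ ∖ K) = 0`). [cite: HatcherAT2002, Prop. 2B.1(a)] -/
theorem isZero_localHomologyOfSet_sphere_four_of_acyclic_compl
    {K : Set (Metric.sphere (0 : EuclideanSpace ℝ (Fin 5)) 1)}
    (hK : ∀ j : ℕ, j ≠ 0 → IsZero (singularHomology R M ↥Kᶜ j)) {q : ℕ} (hq2 : 2 ≤ q) (hq3 : q ≤ 3) :
    IsZero (localHomologyOfSet R M (Metric.sphere (0 : EuclideanSpace ℝ (Fin 5)) 1) K q) := by
  obtain ⟨q, rfl⟩ : ∃ q', q = q' + 1 := ⟨q - 1, by omega⟩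
  exact isZero_localHomologyOfSet_succ_of_isZero R M K q
    (isZero_singularHomology_sphere_holds R M (n := 4) (k := q + 1) (by omega) (by omega))
    (hK q (by omega))

/-- **`H₄(S⁴) ≅ H₄(S⁴ | K)`** for a set `K` whose complement has no homology in degrees `3, 4`.
[cite: HatcherAT2002, Thm. 2.16] -/
theorem isIso_ofAbsolute_sphere_four_of_acyclic_compl
    {K : Set (Metric.sphere (0 : EuclideanSpace ℝ (Fin 5)) 1)}
    (h4 : IsZero (singularHomology R M ↥Kᶜ 4)) (h3 : IsZero (singularHomology R M ↥Kᶜ 3)) :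
    IsIso (relativeSingularHomology.ofAbsolute R M (Metric.sphere (0 : EuclideanSpace ℝ (Fin 5)) 1)
      Kᶜ 4) :=
  isIso_ofAbsolute_of_isZero R M K 3 h4 h3

/-- The complement of the range of a continuous injection of a cube into `S⁴` has no homology in
positive degrees (Hatcher Prop. 2B.1(a), `isZero_compl_range_cube_holds`). [cite: HatcherAT2002, Prop. 2B.1(a)] -/
theorem isZero_singularHomology_compl_range_cube_sphere_four {k : ℕ}
    (ξ : C((Fin k → unitInterval), Metric.sphere (0 : EuclideanSpace ℝ (Fin 5)) 1)) (hξ : Injective ξ)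
    (j : ℕ) (hj : j ≠ 0) : IsZero (singularHomology R M ↥(range ξ)ᶜ j) :=
  SphereComplement.isZero_compl_range_cube_holds R M
    (fun x _ hl => SphereComplement.isZero_compl_singleton_sphere x hl) k ξ hξ j hj

/-- The complement of an embedded circle in `S⁴` has no homology in degrees `≠ 0, 2`
(Hatcher Prop. 2B.1(b)). [cite: HatcherAT2002, Prop. 2B.1(b)] -/
theorem isZero_singularHomology_compl_range_circle_sphere_four
    (γ : Metric.sphere (0 : EuclideanSpace ℝ (Fin 2)) 1 → Metric.sphere (0 : EuclideanSpace ℝ (Fin 5)) 1)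
    (hγ : IsEmbedding γ) {j : ℕ} (hj0 : j ≠ 0) (hj2 : j ≠ 2) :
    IsZero (singularHomology R M ↥(range γ)ᶜ j) :=
  SphereComplement.isZero_compl_range_of_isEmbedding_holds R M (k := 1) (n := 4) (i := j) γ hγ
    (by norm_num) hj0 (by omega)

/-- **Local homology of `S⁴` along an embedded circle in degree `3`**:
`H₃(S⁴ | Γ; M) ≅ H₂(S⁴ ∖ Γ; M) ≅ M` (long exact sequence, then Hatcher Prop. 2B.1(b) in the
degree `4 - 1 - 1 = 2`). [cite: HatcherAT2002, Prop. 2B.1(b)] -/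
theorem nonempty_localHomologyOfSet_sphere_four_circle_three_linearEquiv
    (γ : Metric.sphere (0 : EuclideanSpace ℝ (Fin 2)) 1 → Metric.sphere (0 : EuclideanSpace ℝ (Fin 5)) 1)
    (hγ : IsEmbedding γ) :
    Nonempty (localHomologyOfSet R M (Metric.sphere (0 : EuclideanSpace ℝ (Fin 5)) 1) (range γ) 3 ≃ₗ[R]
      ULift.{0} M) := by
  obtain ⟨e₁⟩ := exists_linearEquiv_compl_of_isZero R M (Z := Metric.sphere (0 : EuclideanSpace ℝ (Fin 5)) 1)
    (range γ) 2 (isZero_singularHomology_sphere_holds R M (n := 4) (k := 3) (by omega) (by omega))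
    (isZero_singularHomology_sphere_holds R M (n := 4) (k := 2) (by omega) (by omega))
  obtain ⟨e₂⟩ := SphereComplement.nonempty_compl_range_iso_coeff_of_isEmbedding R M (k := 1) (m := 3)
    γ hγ (by norm_num)
  exact ⟨e₁ ≪≫ₗ e₂.toLinearEquiv⟩

/-- The open embedding `σ : ℝ⁴ → S⁴` onto the complement of a point (inverse stereographic
projection, `SphereComplement.sphereMinusPointHomeomorph`). [folklore] -/
theorem exists_isOpenEmbedding_euclidean_sphere_four :
    ∃ σ : EuclideanSpace ℝ (Fin 4) → Metric.sphere (0 : EuclideanSpace ℝ (Fin 5)) 1, IsOpenEmbedding σ := by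
  let N : Metric.sphere (0 : EuclideanSpace ℝ (Fin 5)) 1 := ⟨EuclideanSpace.single 0 1, by simp⟩
  refine ⟨Subtype.val ∘ (SphereComplement.sphereMinusPointHomeomorph N).symm, ?_⟩
  exact (isOpen_compl_singleton.isOpenEmbedding_subtypeVal).comp
    (SphereComplement.sphereMinusPointHomeomorph N).symm.isOpenEmbedding

end SphereFour

/-! ### The sets `A = e(𝔻⁴)`, `D = f(𝔻²)`, `Γ = A ∩ D` -/

namespace Knot.IsSliceDiscIn

variable {K : Knot} {X : Type u} [TopologicalSpace X] [ChartedSpace (EuclideanSpace ℝ (Fin 4)) X]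
  {e : EuclideanSpace ℝ (Fin 4) → X} {f : EuclideanSpace ℝ (Fin 2) → X}

/-- The knot `K ⊂ S³ ⊂ ℝ⁴` as a subset of the closed unit ball of `ℝ⁴`. [folklore] -/
theorem range_coe_knot_subset_closedBall (K : Knot) :
    range (fun θ : Metric.sphere (0 : EuclideanSpace ℝ (Fin 2)) 1 =>
      ((K θ : Metric.sphere (0 : EuclideanSpace ℝ (Fin 4)) 1) : EuclideanSpace ℝ (Fin 4))) ⊆
      Metric.closedBall (0 : EuclideanSpace ℝ (Fin 4)) 1 := by
  rintro _ ⟨θ, rfl⟩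
  exact Metric.sphere_subset_closedBall (K θ).2

/-- **`e(𝔻⁴) ∩ f(𝔻²) = e(K)`**: the ball and the proper disc of a slice-disc datum meet exactly
along the knot (the open disc misses `e(𝔻⁴)`, the boundary circle is `e ∘ K`).
[cite: ManolescuPiccirillo2023, Def. 2.1] -/
theorem image_closedBall_inter_image_closedBall_eq (h : K.IsSliceDiscIn X e f) :
    e '' Metric.closedBall (0 : EuclideanSpace ℝ (Fin 4)) 1 ∩
        f '' Metric.closedBall (0 : EuclideanSpace ℝ (Fin 2)) 1 =
      e '' range (fun θ : Metric.sphere (0 : EuclideanSpace ℝ (Fin 2)) 1 =>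
        ((K θ : Metric.sphere (0 : EuclideanSpace ℝ (Fin 4)) 1) : EuclideanSpace ℝ (Fin 4))) := by
  ext y
  constructor
  · rintro ⟨hyA, x, hx, rfl⟩
    have hx1 : ‖x‖ = 1 := by
      rcases (mem_closedBall_zero_iff.1 hx).lt_or_eq with h1 | h1
      · exact absurd hyA (h.apply_notMem h1)
      · exact h1
    refine ⟨_, ⟨⟨x, mem_sphere_zero_iff_norm.2 hx1⟩, rfl⟩, ?_⟩
    exact (h.apply_sphere ⟨x, mem_sphere_zero_iff_norm.2 hx1⟩).symm
  · rintro ⟨_, ⟨θ, rfl⟩, rfl⟩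
    refine ⟨⟨_, Metric.sphere_subset_closedBall (K θ).2, rfl⟩, ⟨(θ : EuclideanSpace ℝ (Fin 2)),
      Metric.sphere_subset_closedBall θ.2, h.apply_sphere θ⟩⟩

/-! ### Local homology along `A` and `Γ`: transfer into `S⁴` through the chart `e` -/

section BallCircle

variable [T2Space X]

omit [ChartedSpace (EuclideanSpace ℝ (Fin 4)) X] in
/-- **Local homology of `X` along the ball `A = e(𝔻⁴)` and the circle `Γ = e(K)`**, for a smooth
(indeed any open) embedding `e : ℝ⁴ → X`: `H_q(X | A; M) = 0` for `q = 2, 3`, `H₂(X | Γ; M) = 0`,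
`H₃(X | Γ; M) ≃ M`, and `H₄(X | A; M) → H₄(X | Γ; M)` is onto — transferred along `e` and the
inverse stereographic projection `σ : ℝ⁴ → S⁴` from the corresponding statements in `S⁴`
(Hatcher Prop. 2B.1 for the injected cube `σ𝔻⁴` and the knot `σ ∘ K`).
[cite: HatcherAT2002, Prop. 2B.1] -/
theorem localHomology_ball_circle {e : EuclideanSpace ℝ (Fin 4) → X} (he : IsOpenEmbedding e)
    (K : Knot) (R : Type) [CommRing R] (M : Type) [AddCommGroup M] [Module R M] :
    (∀ q : ℕ, 2 ≤ q → q ≤ 3 →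
      IsZero (localHomologyOfSet R M X (e '' Metric.closedBall (0 : EuclideanSpace ℝ (Fin 4)) 1) q)) ∧
    IsZero (localHomologyOfSet R M X (e '' range (fun θ : Metric.sphere (0 : EuclideanSpace ℝ (Fin 2)) 1 =>
        ((K θ : Metric.sphere (0 : EuclideanSpace ℝ (Fin 4)) 1) : EuclideanSpace ℝ (Fin 4)))) 2) ∧
    Nonempty (localHomologyOfSet R M X (e '' range (fun θ : Metric.sphere (0 : EuclideanSpace ℝ (Fin 2)) 1 =>
        ((K θ : Metric.sphere (0 : EuclideanSpace ℝ (Fin 4)) 1) : EuclideanSpace ℝ (Fin 4)))) 3 ≃ₗ[R]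
      ULift.{0} M) ∧
    Surjective (restrictLocal R M (Set.image_mono (range_coe_knot_subset_closedBall K) :
      e '' range (fun θ : Metric.sphere (0 : EuclideanSpace ℝ (Fin 2)) 1 =>
        ((K θ : Metric.sphere (0 : EuclideanSpace ℝ (Fin 4)) 1) : EuclideanSpace ℝ (Fin 4))) ⊆
        e '' Metric.closedBall (0 : EuclideanSpace ℝ (Fin 4)) 1) 4) := by
  -- notation
  set K₀ : Set (EuclideanSpace ℝ (Fin 4)) := Metric.closedBall 0 1 with hK₀
  set κ : Metric.sphere (0 : EuclideanSpace ℝ (Fin 2)) 1 → EuclideanSpace ℝ (Fin 4) :=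
    fun θ => ((K θ : Metric.sphere (0 : EuclideanSpace ℝ (Fin 4)) 1) : EuclideanSpace ℝ (Fin 4)) with hκ
  set L₀ : Set (EuclideanSpace ℝ (Fin 4)) := range κ with hL₀
  have hLK : L₀ ⊆ K₀ := range_coe_knot_subset_closedBall K
  have hκc : Continuous κ := continuous_subtype_val.comp K.isSmoothEmbedding.contMDiff.continuous
  have hκi : Injective κ := Subtype.val_injective.comp K.isSmoothEmbedding.isEmbedding.injective
  have hK₀c : IsCompact K₀ := isCompact_closedBall _ _
  have hL₀c : IsCompact L₀ := isCompact_range hκc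
  obtain ⟨σ, hσ⟩ := exists_isOpenEmbedding_euclidean_sphere_four
  -- the sets in `S⁴`: an injected cube and an embedded circle
  have hσK : σ '' K₀ = range (σ ∘ SphereComplement.cubeToBall (m := 4)) := by
    rw [range_comp, SphereComplement.range_cubeToBall]
  have hσL : σ '' L₀ = range (σ ∘ κ) := by rw [hL₀, range_comp]
  have hcube : ∀ j : ℕ, j ≠ 0 → IsZero (singularHomology R M ↥(σ '' K₀)ᶜ j) := by
    intro j hj
    rw [hσK]
    exact isZero_singularHomology_compl_range_cube_sphere_four R M
      ⟨σ ∘ SphereComplement.cubeToBall, hσ.continuous.comp SphereComplement.continuous_cubeToBall⟩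
      (hσ.injective.comp SphereComplement.cubeToBall_injective) j hj
  have hγ : IsEmbedding (σ ∘ κ) :=
    ((hσ.continuous.comp hκc).isClosedEmbedding (hσ.injective.comp hκi)).isEmbedding
  have hcirc : ∀ j : ℕ, j ≠ 0 → j ≠ 2 → IsZero (singularHomology R M ↥(σ '' L₀)ᶜ j) := by
    intro j hj0 hj2
    rw [hσL]
    exact isZero_singularHomology_compl_range_circle_sphere_four R M (σ ∘ κ) hγ hj0 hj2
  -- closedness of the images
  have heK : IsClosed (e '' K₀) := (hK₀c.image he.continuous).isClosed
  have heL : IsClosed (e '' L₀) := (hL₀c.image he.continuous).isClosed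
  have hσKc : IsClosed (σ '' K₀) := (hK₀c.image hσ.continuous).isClosed
  have hσLc : IsClosed (σ '' L₀) := (hL₀c.image hσ.continuous).isClosed
  -- the transfers
  refine ⟨fun q hq2 hq3 => ?_, ?_, ?_, ?_⟩
  · rw [← localHomologyOfSet.isZero_iff_of_isOpenEmbedding R M he heK q,
      localHomologyOfSet.isZero_iff_of_isOpenEmbedding R M hσ hσKc q]
    exact isZero_localHomologyOfSet_sphere_four_of_acyclic_compl R M hcube hq2 hq3
  · rw [← localHomologyOfSet.isZero_iff_of_isOpenEmbedding R M he heL 2,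
      localHomologyOfSet.isZero_iff_of_isOpenEmbedding R M hσ hσLc 2]
    exact isZero_localHomologyOfSet_succ_of_isZero R M _ 1
      (isZero_singularHomology_sphere_holds R M (n := 4) (k := 2) (by omega) (by omega))
      (hcirc 1 one_ne_zero (by omega))
  · obtain ⟨T₁, -, -⟩ := localHomologyOfSet.exists_linearEquiv_pair_of_isOpenEmbedding R M he
      (subset_refl L₀) heL heL 3
    obtain ⟨T₂, -, -⟩ := localHomologyOfSet.exists_linearEquiv_pair_of_isOpenEmbedding R M hσ
      (subset_refl L₀) hσLc hσLc 3
    have hγ' : IsEmbedding (σ ∘ κ) := hγ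
    obtain ⟨T₃⟩ := nonempty_localHomologyOfSet_sphere_four_circle_three_linearEquiv R M (σ ∘ κ) hγ'
    rw [← hσL] at T₃
    exact ⟨T₁.symm ≪≫ₗ (T₂ ≪≫ₗ T₃)⟩
  · rw [← localHomologyOfSet.surjective_restrictLocal_iff_of_isOpenEmbedding R M he hLK heK heL 4,
      localHomologyOfSet.surjective_restrictLocal_iff_of_isOpenEmbedding R M hσ hLK hσKc hσLc 4]
    haveI := isIso_ofAbsolute_sphere_four_of_acyclic_compl R M (hcube 4 (by omega)) (hcube 3 (by omega))
    haveI := isIso_ofAbsolute_sphere_four_of_acyclic_compl R M (hcirc 4 (by omega) (by omega))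
      (hcirc 3 (by omega) (by omega))
    exact surjective_restrictLocal_of_isIso_ofAbsolute R M (Set.image_mono hLK) 4

end BallCircle

/-! ### Local homology along the disc `D`: shrink into a chart, then transfer into `S⁴` -/

section Disc

variable [T2Space X] [CompactSpace X] [IsManifold (𝓡 4) ∞ X]

/-- **Local homology of `X` along the smooth proper disc `D = f(𝔻²)` vanishes in degrees `2, 3`**:
an ambient isotopy of the closed manifold `X` shrinks `D` onto `f(r𝔻²)` inside the chart at
`f 0` (`exists_homeomorph_image_disc_eq`), where the local homology is that of `S⁴` along an
injected square (acyclic complement, Hatcher Prop. 2B.1(a)). [cite: HatcherAT2002, Prop. 2B.1(a)] -/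
theorem isZero_localHomologyOfSet_disc (h : K.IsSliceDiscIn X e f) (R : Type) [CommRing R]
    (M : Type) [AddCommGroup M] [Module R M] {q : ℕ} (hq2 : 2 ≤ q) (hq3 : q ≤ 3) :
    IsZero (localHomologyOfSet R M X (f '' Metric.closedBall (0 : EuclideanSpace ℝ (Fin 2)) 1) q) := by
  -- shrink the disc into the chart at `f 0`
  set c := chartAt (EuclideanSpace ℝ (Fin 4)) (f 0) with hc
  obtain ⟨r, hr0, hr1, Ψ, hrW, hΨ⟩ := exists_homeomorph_image_disc_eq (n := 1) (m := 4) h.contMDiff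
    h.injOn (fun y hy => h.mfderiv_injective hy) c.open_source (mem_chart_source _ (f 0))
  set D' : Set X := f '' Metric.closedBall (0 : EuclideanSpace ℝ (Fin 2)) r with hD'
  have hD'c : IsCompact D' := (isCompact_closedBall _ _).image h.contMDiff.continuous
  have hD's : D' ⊆ c.source := hrW
  -- move along `Ψ`
  rw [isZero_iff_of_linearEquiv R (localHomologyOfSet.xEquiv R M Ψ
    (f '' Metric.closedBall (0 : EuclideanSpace ℝ (Fin 2)) 1) q), hΨ]
  -- the chart as an open embedding of its target
  set O : Set (EuclideanSpace ℝ (Fin 4)) := c.target with hO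
  let κ₁ : O → X := fun o => c.symm o.1
  have hκ₁ : IsOpenEmbedding κ₁ := c.symm.isOpenEmbedding_restrict
  set K₁ : Set O := {o | c.symm o.1 ∈ D'} with hK₁
  have hκ₁K : κ₁ '' K₁ = D' := by
    ext y
    constructor
    · rintro ⟨o, ho, rfl⟩
      exact ho
    · intro hy
      refine ⟨⟨c y, c.map_source (hD's hy)⟩, ?_, ?_⟩
      · change c.symm (c y) ∈ D'
        rwa [c.left_inv (hD's hy)]
      · change c.symm (c y) = y
        rw [c.left_inv (hD's hy)]
  rw [← hκ₁K, ← localHomologyOfSet.isZero_iff_of_isOpenEmbedding R M hκ₁ (by rw [hκ₁K]; exact hD'c.isClosed) q]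
  -- into `S⁴`
  obtain ⟨σ, hσ⟩ := exists_isOpenEmbedding_euclidean_sphere_four
  have hκ₂ : IsOpenEmbedding (σ ∘ (Subtype.val : O → EuclideanSpace ℝ (Fin 4))) :=
    hσ.comp c.open_target.isOpenEmbedding_subtypeVal
  -- the image is an injected square
  let ξ : (Fin 2 → unitInterval) → Metric.sphere (0 : EuclideanSpace ℝ (Fin 5)) 1 :=
    fun x => σ (c (f (r • SphereComplement.cubeToBall x)))
  have hfr : ∀ x : Fin 2 → unitInterval, f (r • SphereComplement.cubeToBall x) ∈ D' := fun x =>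
    ⟨r • SphereComplement.cubeToBall x, by
      rw [mem_closedBall_zero_iff, norm_smul, Real.norm_eq_abs, abs_of_pos hr0]
      nlinarith [SphereComplement.norm_cubeToBall_le (m := 2) x], rfl⟩
  have hξc : Continuous ξ := by
    refine hσ.continuous.comp ?_
    refine c.continuousOn.comp_continuous
      (h.contMDiff.continuous.comp (SphereComplement.continuous_cubeToBall.const_smul r))
      fun x => hD's (hfr x)
  have hξi : Injective ξ := by
    intro x y hxy
    have h1 : c (f (r • SphereComplement.cubeToBall x)) = c (f (r • SphereComplement.cubeToBall y)) :=
      hσ.injective hxy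
    have h2 : f (r • SphereComplement.cubeToBall x) = f (r • SphereComplement.cubeToBall y) :=
      c.injOn (hD's (hfr x)) (hD's (hfr y)) h1
    have hmem : ∀ z : Fin 2 → unitInterval, r • SphereComplement.cubeToBall z ∈
        Metric.closedBall (0 : EuclideanSpace ℝ (Fin 2)) 1 := fun z => by
      rw [mem_closedBall_zero_iff, norm_smul, Real.norm_eq_abs, abs_of_pos hr0]
      nlinarith [SphereComplement.norm_cubeToBall_le (m := 2) z]
    have h3 := h.injOn (hmem x) (hmem y) h2
    exact SphereComplement.cubeToBall_injective (smul_right_injective _ hr0.ne' h3)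
  have hξK : (σ ∘ (Subtype.val : O → EuclideanSpace ℝ (Fin 4))) '' K₁ = range ξ := by
    ext s
    constructor
    · rintro ⟨o, ho, rfl⟩
      obtain ⟨z, hz, hzo⟩ : c.symm o.1 ∈ D' := ho
      obtain ⟨x, rfl⟩ : z ∈ range (fun x : Fin 2 → unitInterval => r • SphereComplement.cubeToBall x) := by
        rw [show range (fun x : Fin 2 → unitInterval => r • SphereComplement.cubeToBall x) =
            Metric.closedBall 0 r from ?_]
        · exact hz
        rw [show (fun x : Fin 2 → unitInterval => r • SphereComplement.cubeToBall x) =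
            (fun y => r • y) ∘ SphereComplement.cubeToBall from rfl, range_comp,
          SphereComplement.range_cubeToBall, Set.image_smul, smul_closedBall' hr0.ne', smul_zero,
          Real.norm_eq_abs, abs_of_pos hr0, mul_one]
      refine ⟨x, ?_⟩
      change σ (c (f (r • SphereComplement.cubeToBall x))) = σ o.1
      rw [hzo, c.right_inv o.2]
    · rintro ⟨x, rfl⟩
      refine ⟨⟨c (f (r • SphereComplement.cubeToBall x)), c.map_source (hD's (hfr x))⟩, ?_, rfl⟩
      change c.symm (c (f (r • SphereComplement.cubeToBall x))) ∈ D'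
      rw [c.left_inv (hD's (hfr x))]
      exact hfr x
  have hclosed : IsClosed ((σ ∘ (Subtype.val : O → EuclideanSpace ℝ (Fin 4))) '' K₁) := by
    rw [hξK]
    exact (isCompact_range hξc).isClosed
  rw [localHomologyOfSet.isZero_iff_of_isOpenEmbedding R M hκ₂ hclosed q, hξK]
  exact isZero_localHomologyOfSet_sphere_four_of_acyclic_compl R M
    (isZero_singularHomology_compl_range_cube_sphere_four R M ⟨ξ, hξc⟩ hξi) hq2 hq3

end Disc

/-! ### Local homology along `C = A ∪ D` -/

section Union

variable [T2Space X] [CompactSpace X] [IsManifold (𝓡 4) ∞ X]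

/-- Transport of surjectivity of restriction maps along an equality of the smaller set. [folklore] -/
theorem surjective_restrictLocal_congr {Y : Type u} [TopologicalSpace Y] {R : Type} [CommRing R]
    {M : Type} [AddCommGroup M] [Module R M]
    {K L L' : Set Y} (hL : L = L') (h₁ : L ⊆ K) (h₂ : L' ⊆ K) (q : ℕ) :
    Surjective (restrictLocal R M h₁ q) ↔ Surjective (restrictLocal R M h₂ q) := by
  subst hL
  rfl

/-- **`H₃(X | e(𝔻⁴) ∪ f(𝔻²); M) = 0`** for a slice-disc datum `(e, f)` in a closed smooth
`4`-manifold (relative Mayer–Vietoris: `H₃(X | A) = H₃(X | D) = 0` and `H₄(X | A) → H₄(X | Γ)`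
onto; in the source's handle language, `H₃(X(K'), ∂X(K')) = 0` for the `0`-trace).
[cite: ManolescuPiccirillo2023, §3.2, proof of Lemma 3.3] -/
theorem isZero_localHomologyOfSet_ball_union_disc_three (h : K.IsSliceDiscIn X e f) (R : Type)
    [CommRing R] (M : Type) [AddCommGroup M] [Module R M] :
    IsZero (localHomologyOfSet R M X (e '' Metric.closedBall (0 : EuclideanSpace ℝ (Fin 4)) 1 ∪
      f '' Metric.closedBall (0 : EuclideanSpace ℝ (Fin 2)) 1) 3) := by
  have he : IsOpenEmbedding e := isOpenEmbedding_disc (I := 𝓡 4) h.isSmoothEmbedding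
  obtain ⟨hA, -, -, hsurj⟩ := localHomology_ball_circle he K R M
  have hAD := h.image_closedBall_inter_image_closedBall_eq
  have hAc : IsClosed (e '' Metric.closedBall (0 : EuclideanSpace ℝ (Fin 4)) 1) :=
    ((isCompact_closedBall _ _).image he.continuous).isClosed
  have hDc : IsClosed (f '' Metric.closedBall (0 : EuclideanSpace ℝ (Fin 2)) 1) :=
    ((isCompact_closedBall _ _).image h.contMDiff.continuous).isClosed
  refine localHomologyOfSet.isZero_localHomologyOfSet_union R M hAc hDc 3 (hA 3 (by omega) le_rfl)
    (h.isZero_localHomologyOfSet_disc R M (by omega) le_rfl) ?_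
  exact (surjective_restrictLocal_congr hAD.symm _ Set.inter_subset_left 4).1 hsurj

/-- **`H₂(X | e(𝔻⁴) ∪ f(𝔻²); M) ≃ M`** for a slice-disc datum `(e, f)` in a closed smooth
`4`-manifold: by relative Mayer–Vietoris `H₂(X | A ∪ D) ≅ H₃(X | A ∩ D) = H₃(X | Γ)`, and
`H₃(X | Γ) ≅ H₂(S⁴ ∖ σK) ≅ M` (in the source's handle language, `H₂(X(K'), ∂X(K')) ≅ ℤ` for the
`0`-trace, generated by the cocore disc). [cite: ManolescuPiccirillo2023, §3.2, proof of Lemma 3.3] -/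
theorem nonempty_localHomologyOfSet_ball_union_disc_two_linearEquiv (h : K.IsSliceDiscIn X e f)
    (R : Type) [CommRing R] (M : Type) [AddCommGroup M] [Module R M] :
    Nonempty (localHomologyOfSet R M X (e '' Metric.closedBall (0 : EuclideanSpace ℝ (Fin 4)) 1 ∪
      f '' Metric.closedBall (0 : EuclideanSpace ℝ (Fin 2)) 1) 2 ≃ₗ[R] ULift.{0} M) := by
  have he : IsOpenEmbedding e := isOpenEmbedding_disc (I := 𝓡 4) h.isSmoothEmbedding
  obtain ⟨hA, hΓ2, ⟨TΓ⟩, -⟩ := localHomology_ball_circle he K R M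
  have hAD := h.image_closedBall_inter_image_closedBall_eq
  have hAc : IsClosed (e '' Metric.closedBall (0 : EuclideanSpace ℝ (Fin 4)) 1) :=
    ((isCompact_closedBall _ _).image he.continuous).isClosed
  have hDc : IsClosed (f '' Metric.closedBall (0 : EuclideanSpace ℝ (Fin 2)) 1) :=
    ((isCompact_closedBall _ _).image h.contMDiff.continuous).isClosed
  obtain ⟨TMV⟩ := localHomologyOfSet.exists_linearEquiv_localHomologyOfSet_inter_union R M hAc hDc 2
    (hA 3 (by omega) le_rfl) (h.isZero_localHomologyOfSet_disc R M (by omega) le_rfl)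
    (hA 2 le_rfl (by omega)) (h.isZero_localHomologyOfSet_disc R M le_rfl (by omega))
  rw [hAD] at TMV
  exact ⟨TMV.symm ≪≫ₗ TΓ⟩

end Union

end Knot.IsSliceDiscIn

end Literature.Topology.FourManifolds
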